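import Mathlib
import HarnessLib
import HarnessLib.Audit
import Summits.AtomisticToContinuum.Statement
import Literature.Analysis.FluidPDE.HardSphereFlowConstruction

/-!
Route: MaxwellianCollisionCLT

CLOSED (retired) 2026-08-15T13:55:47Z by operator:999:2305528 — reason: not-a-thesis: assembly does not conclude the sub-problem Statement — note: D-0027 §2.1 audit (human 2026-08-15: routes that do not decide the summit are removed): the assembly concludes `Literature.MathematicalPhysics.KineticTheory.HydrodynamicLimit`, not the sub-problem statement; a NEW conforming route may be opened from the same idea (generated `closes : … → _root_.Hydr. The file is kept as the record of this route; refuted decls are indexed as negative knowledge (`ledger negatives`).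

# Route MaxwellianCollisionCLT — local Maxwellian by a CLT along the exact collision isometries of
the hard-sphere flow

It suffices to show X = KineticClosure (target, rank 0): for σ < σ₀ and local Gibbs data, at every
macroscopic time t > 0
the KINETIC half of the Euler closure holds — tested against any continuous χ, the empirical kinetic
stress
(N+1)⁻¹Σχ(xᵢ)vᵢ⊗vᵢ and kinetic energy flux (N+1)⁻¹Σχ(xᵢ)½|vᵢ|²vᵢ of the deterministically evolved
configuration
equal the ideal-gas Euler fluxes u_ℓ⊗u_ℓ + θ_ℓ𝟙 and (½e_ℓ + θ_ℓ)u_ℓ of the particle's own ℓ_N-block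
fields, in
probability, along one mesoscale ℓ_N → 0 with (N+1)ℓ_N³ → ∞ (isotropic stress, no kinetic heat flux:
a local
Maxwellian at flux level). The card maxwellian-clt-collision-isometries (spine, sole card) delivers
X as
DiffuseBackwardInfluence (its crux 1) + AdaptedWeightCLT (its crux 2) along the EXACT isometric
representation
vᵢ(t) = Σ_k M_ik v_k(t−Δ) of the flow; sufficiency of X is the separate crux KineticToHydro (its
crux 3:
collisional half, tails, mv weak–strong assembly).
Lean: `let bw := fun (N : ℕ) (y : Literature.Analysis.FluidPDE.Config (N + 1) (Fin 3) (UnitAddTorus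
(Fin 3))) (l : ℝ) (i j : Fin (N + 1)) => max (1 - dist (y j).1 (y i).1 / l) 0; let bu := fun (N : ℕ)
(y : Literature.Analysis.FluidPDE.Config (N + 1) (Fin 3) (UnitAddTorus (Fin 3))) (l : ℝ) (i : Fin (N
+ 1)) => (∑ j, bw N y l i j)⁻¹ • ∑ j, bw N y l i j • (y j).2; let be := fun (N : ℕ) (y :
Literature.Analysis.FluidPDE.Config (N + 1) (Fin 3) (UnitAddTorus (Fin 3))) (l : ℝ) (i : Fin (N +
1)) => (∑ j, bw N y l i j)⁻¹ * ∑ j, bw N y l i j * ‖(y j).2‖ ^ 2; let bθ := fun (N : ℕ) (y :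
Literature.Analysis.FluidPDE.Config (N + 1) (Fin 3) (UnitAddTorus (Fin 3))) (l : ℝ) (i : Fin (N +
1)) => (be N y l i - ‖bu N y l i‖ ^ 2) / 3; let S := fun (N : ℕ) (y :
Literature.Analysis.FluidPDE.Config (N + 1) (Fin 3) (UnitAddTorus (Fin 3))) (l : ℝ) (χ :
UnitAddTorus (Fin 3) → ℝ) (a b : Fin 3) => ((N + 1 : ℕ) : ℝ)⁻¹ * ∑ i, χ (y i).1 * ((y i).2 a * (y
i).2 b - (bu N y l i a * bu N y l i b + (if a = b then bθ N y l i else 0))); let Q := fun (N : ℕ) (y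
: Literature.Analysis.FluidPDE.Config (N + 1) (Fin 3) (UnitAddTorus (Fin 3))) (l : ℝ) (χ :
UnitAddTorus (Fin 3) → ℝ) (a : Fin 3) => ((N + 1 : ℕ) : ℝ)⁻¹ * ∑ i, χ (y i).1 * (‖(y i).2‖ ^ 2 / 2 *
(y i).2 a - (be N y l i / 2 + bθ N y l i) * bu N y l i a); ∀ (a₀ θ₀ : UnitAddTorus (Fin 3) → ℝ) (u₀
: UnitAddTorus (Fin 3) → EuclideanSpace ℝ (Fin 3)), Continuous a₀ → Continuous θ₀ → Continuous u₀ →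
(∀ x, 0 < a₀ x) → (∀ x, 0 < θ₀ x) → ∃ σ₀ : ℝ, 0 < σ₀ ∧ ∀ σ : ℝ, 0 < σ → σ < σ₀ → ∀ Φ : (N : ℕ) →
Literature.Analysis.FluidPDE.HardSphereFlow (Literature.Analysis.FluidPDE.Torus.geometry (Fin 3))
(Literature.MathematicalPhysics.KineticTheory.hsDiameter σ N) (N + 1), ∃ ℓ : ℕ → ℝ, (∀ N, 0 < ℓ N) ∧
Filter.Tendsto ℓ Filter.atTop (nhds 0) ∧ Filter.Tendsto (fun N : ℕ => ((N + 1 : ℕ) : ℝ) * ℓ N ^ 3)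
Filter.atTop Filter.atTop ∧ ∀ t : ℝ, 0 < t → ∀ χ : UnitAddTorus (Fin 3) → ℝ, Continuous χ → ∀ δ > (0
: ℝ), (∀ a b : Fin 3, Filter.Tendsto (fun N : ℕ =>
Literature.MathematicalPhysics.KineticTheory.localGibbsLaw σ a₀ u₀ θ₀ N (Φ N) {z | δ < |S N ((Φ
N).flow t z) (ℓ N) χ a b|}) Filter.atTop (nhds 0)) ∧ (∀ a : Fin 3, Filter.Tendsto (fun N : ℕ =>
Literature.MathematicalPhysics.KineticTheory.localGibbsLaw σ a₀ u₀ θ₀ N (Φ N) {z | δ < |Q N ((Φ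
N).flow t z) (ℓ N) χ a|}) Filter.atTop (nhds 0))`

## Assembly
Elementary real analysis + modus ponens: fix profiles; take σ₀ = min of the σ₀'s of
DiffuseBackwardInfluence and
AdaptedWeightCLT; for σ < σ₀ and Φ get the window Δ from DiffuseBackwardInfluence and put ℓ_N :=
Δ_N^(1/2)(N+1)^(−1/6):
then ℓ_N/Δ_N = (Δ_N(N+1)^(1/3))^(−1/2) → 0, (N+1)ℓ_N³ = (Δ_N(N+1)^(1/3))^(3/2) → ∞, ℓ_N → 0, so
AdaptedWeightCLT gives
KC(t, ℓ) for all t > 0, i.e. KineticClosure (its text is verbatim the hypothesis of KineticToHydro —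
checked by `example`
in SketchTest.lean); KineticToHydro then yields
Literature.MathematicalPhysics.KineticTheory.HydrodynamicLimit (=
the conjunct `HydrodynamicLimit`, an abbrev). TransferIsometry/TransferRepresentsFlow are not needed
for the implication;
they certify that the typed M is the card's matrix (normalisation Σ_k‖M_ik‖² = 3 and the pathwise
identity).

Rationale: WHY THIS LINE. Along every realised hard-sphere path the velocity configuration at time t is an
orthogonal image of the one at t−Δ
(product of the collision reflections, CIP1994 §4.2, SimanyiSzasz1999): vᵢ(t) = Σ_k M_ik v_k(t−Δ)
with Σ_k M_ik M_ikᵀ = I₃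
exactly, recollisions included — Lindeberg's normalisation written down by the dynamics. If the rows
of M are DIFFUSE
(inverse participation ratio → 0 over a window of n_N → ∞ mean free times, Δ_N → 0) a central limit
theorem for these
adapted isometric weights makes vᵢ(t) conditionally Gaussian and isotropic: temperature is the
variance of a CLT and the
Maxwellian its Gaussian, which is exactly the flux-level kinetic closure X. Imported area:
probability — CLTs with
dependent/adapted arrays (Chatterjee2006 Lindeberg replacement, martingale CLT) and McKean-tree CLTs
for Maxwell/Kac
molecules (Mckean1966, CarlenCarvalhoGabetta2000, GabettaRegazzini2008, DoleraRegazzini2010),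
transplanted from
velocity-blind stochastic trees to the velocity-selected deterministic collision forest;
deterministic precedent
DurrGoldsteinLebowitz1981 (Maxwellian of a heavy particle by a CLT over collisions). No prior route
uses a
velocity-level LINEAR identity: RelEntropyErgodic/ChaoticMixing/VanishingNoise go through Gibbs
classification or
mixing (BoltzmannHypothesis barrier), DenseKineticExpansion through cumulant expansions
(NoDensityExpansion barrier),
DissipativeWeakStrong leaves its flux closure informal — this route types the kinetic half of that
closure and docks
into the same mv weak–strong assembly. The transfer M is typed TODAY over the proved Alexander
construction
(Literature.Analysis.FluidPDE.Alexander.stateAfter/incomingPairs/collisionCount; torusFlow_*_holds).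

RANKED CRUXES. #0 KineticClosure (target) — X as in § Thesis: ∀ continuous profiles ∃ σ₀ ∀ σ ∈
(0,σ₀) ∀ flows Φ ∃ mesoscale ℓ_N (0 < ℓ_N → 0, (N+1)ℓ_N³ → ∞) ∀ t > 0 ∀ χ continuous ∀ δ > 0:
localGibbsLaw-probability that the χ-tested kinetic stress defect (entrywise) or kinetic energy-flux
defect relative to the ℓ_N-block fields (tent weights max(1 − dist/ℓ, 0), block mean velocity u_ℓ,
block ⟨|v|²⟩ = e_ℓ, θ_ℓ = (e_ℓ − |u_ℓ|²)/3, evaluated at each particle) of (Φ N).flow t z exceeds δ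
tends to 0. (why it might fail: it is flux-level local equilibrium for deterministic spheres at
fixed σ — no mechanism weaker than the conjunct's is known to give it (Spohn1991 I.3: no proof of
such dynamical mixing); false for the free gas (rest-frame heat current,
BoltzmannHypothesisBarrierNarrow kernel (5)).) [Spohn1991, OllaVaradhanYau1993, CIP1994]
#2 AdaptedWeightCLT (crux) — card crux 2 (ADAPTED-WEIGHT CLT ⇒ LOCAL MAXWELLIAN): ∀ profiles ∃ σ₀ ∀
σ < σ₀ ∀ Φ ∀ window/block sequences Δ_N, ℓ_N > 0 with Δ_N → 0, ℓ_N/Δ_N → 0, (N+1)ℓ_N³ → ∞, ∀ t > 0: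
IF the frozen-geometry velocity transfer M over [t−Δ_N, t] (fold of the linear collision reflections
of the Alexander construction started at (Φ N).flow (t−Δ_N) z) has vanishing mean inverse
participation ratio E[(N+1)⁻¹Σᵢ Σ_k ‖M_ik‖_F⁴] → 0 under the local Gibbs law, THEN the kinetic
closure KC(t, ℓ) of the target holds at t. Rotational diffuseness of the products of reflections and
pair decorrelation of ancestor velocities at kinetic separations are to be proved inside (foreseen
split). [difficulty: XL] (why it might fail: the weights are adapted (collision times/normals depend
on the summands; |g·ω|-biased tree): selection bias may tilt the limit off Gaussian at O(1) unless
it enters only via the flux factor — 'chaos in CLT clothing' (refuter audit); ancestor decorrelation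
at scale N^(-1/3) is open.) [Chatterjee2006, GabettaRegazzini2008, DoleraRegazzini2010,
CarlenCarvalhoGabetta2000, Mckean1966, CercignaniGabetta2007, DurrGoldsteinLebowitz1981]
#3 DiffuseBackwardInfluence (crux) — card crux 1 (DIFFUSE BACKWARD INFLUENCE, uniform in N): ∀
profiles ∃ σ₀ ∀ σ < σ₀ ∀ Φ ∃ window Δ_N > 0 with Δ_N → 0 and Δ_N(N+1)^(1/3) → ∞ (n_N → ∞ mean free
times) such that ∀ t > 0 the local-Gibbs expectation of the mean inverse participation ratio
(N+1)⁻¹Σᵢ Σ_k ‖M_ik(t, t−Δ_N)‖_F⁴ of the rows of the frozen-geometry transfer tends to 0 (rows have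
‖·‖_F² = 3 exactly, TransferIsometry; ipr ∈ [9/(N+1), 9]). [difficulty: L] (why it might fail:
weight re-concentration in transient dense clusters (rattlers) or a non-vanishing fraction of
particles with O(1) collisions in n_N mean free times; O(φ)-rare per step, but 'uniform in N along
the non-equilibrium law at t > 0' has no a-priori estimate beyond energy/entropy.)
[SimanyiSzasz1999, CIP1994, GST2013, DewijnVanbeijeren2004, Alexander1975]
#4 KineticToHydro (crux) — card crux 3 (COLLISIONAL HALF + TAILS + ASSEMBLY): KineticClosure →
HydrodynamicLimit. Given the kinetic half at one mesoscale, derive the conjunct: collisional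
momentum/energy transfer closes to the excess pressure ρθ(Z(ρσ³) − 1)𝟙 and its work flux (virial,
contact-pair statistics at fixed σ), cubic velocity tails give time-integrated L¹ fluxes, limit
points are dissipative measure-valued hs-Euler solutions and relative-energy weak–strong uniqueness
(BrezinaFeireisl2018, Dafermos1979; route DissipativeWeakStrong items FluxClosure/HsEntropyConvex)
pins them to the classical solution before the first shock; t = 0 from the LLN hypothesis. [deps:
KineticClosure] [difficulty: XL] (why it might fail: collisional transfer needs contact-pair
statistics at distance ε, untouched by this engine; if contact correlations stay non-product at
leading order the collisional pressure is not ρθ(Z−1) and HydrodynamicLimit fails with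
KineticClosure true; entropy admissibility of limit points is open too.) [BrezinaFeireisl2018,
Dafermos1979, Spohn1991, OllaVaradhanYau1993, KipnisLandim1999]
#9 TransferIsometry (support) — for every σ, N, configuration y and Δ the frozen-geometry transfer W
↦ M N y Δ W (fold over k < collisionCount of: replace velocities by W, collide the incoming contact
pair of the k-th pre-collisional configuration of the Alexander dynamics) is additive, homogeneous,
preserves Σᵢ‖Wᵢ‖², and every row has Frobenius weight Σ_k Σ_a ‖M(e_k⊗e_a)ᵢ‖² = 3 (orthogonality;
reflectVel is a linear isometry of V3×V3 for every normal, identity at 0). [difficulty: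
provable-now] [CIP1994, GST2013, SimanyiSzasz1999]
#9 TransferRepresentsFlow (support) — for 0 < σ < 1/2, every N, every hard-sphere flow Φ of N+1
spheres of diameter hsDiameter σ N on 𝕋³, every s and Δ ≥ 0: for Liouville-a.e. z the velocities of
Φ.flow (s+Δ) z are the transfer M N (Φ.flow s z) Δ applied to the velocities of Φ.flow s z
(trajectory uniqueness GST2013 §4.1 / flow_eq_ae_holds +
torusFlow_isTrajectory/ae_good/measurePreserving_holds + hsDiameter_le; induction on the collision
count: freeFlight keeps velocities, collisionStep = collidePair at the pre-collisional positions).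
[difficulty: provable-now] [Alexander1975, CIP1994, GST2013]

TWO-LAYER PLAN. Foreseen glued splits (none filed now): AdaptedWeightCLT ⇐ KineticScaleDecorrelation
(pair statistics of bounded
one-body velocity observables factorise at separations R·N^(−1/3), R → ∞, under the time-s law) →
RotationalDiffuseness
(directions M_ik/‖M_ik‖ asymptotically isotropic over k: products of n reflections with the realised
normals forget
orientation) → ConditionalCLT (given those two and diffuseness, Lindeberg replacement along the
backward collision
filtration ⇒ KC) → AdaptedWeightCLT. KineticToHydro ⇐ CollisionalVirialClosure (collisional
stress/work flux =
ρθ(Z−1)-terms of block fields) → MvEntropyWeakStrong (typed version of DissipativeWeakStrong's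
FluxClosure +
MvWeakStrongUniquenessHS with the kinetic half given) → KineticToHydro. DiffuseBackwardInfluence ⇐
FewCollisionsRare (fraction of particles with ≤ m collisions in n_N mean free times → 0 uniformly in
N) →
NoReconcentration (ipr decays along rows between rare events) → DiffuseBackwardInfluence.

KILL CRITERIA. ¬DiffuseBackwardInfluence at every small σ (an N-uniform positive fraction of
localised rows, e.g. weight trapped in
clusters: an MD participation-ratio plateau ≪ N made rigorous, or a measure-theoretic obstruction)
closes the route
`refuted:DiffuseBackwardInfluence` — the card's only engine. ¬AdaptedWeightCLT with diffuseness
intact (a local Gibbs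
family whose time-t kinetic stress stays anisotropic at some mesoscale although rows are diffuse)
closes it
`refuted:AdaptedWeightCLT` and is strong evidence for ¬HydrodynamicLimit — file ¬KineticClosure
then. The cheapest
analytic version: the adapted-weight CLT computed for the EQUILIBRIUM gas or for the stochastic
hard-sphere Kac system
must return exactly the Maxwellian; a non-Gaussian limit there retires the card (pivot impossible).
¬KineticToHydro can
only come from ¬HydrodynamicLimit itself (collisional channel) — then every route dies.
KineticClosure proved elsewhere
(e.g. by one-flight-standard-pairs-kac or kinetic-windows-inside-yau engines) moots cruxes 2–3 but
not 4.

NOT DECOMPOSED YET. The three inputs hidden in AdaptedWeightCLT (kinetic-scale pair decorrelation,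
rotational diffuseness, the conditional
CLT proper) — layer-2 children once a grounder has stamped the signature; the collisional half
inside KineticToHydro
(shared in substance with DissipativeWeakStrong's informal FluxClosure
stmt-AtomisticToContinuum-0823 — to be typed
there or split here, not both); constants (rate e^(−cn) in crux 3, Berry–Esseen Σ‖M_ik‖³); d = 2
disks; the t = 0 /
initial-layer bookkeeping; measurability of ipr (routine from torusFlow_measurable_holds). No
definition request is
needed: M, ipr and the block fields are inlined `let`s over existing declarations.

CHEAPEST FALSIFIER. (i) Equilibrium consistency, analytically at the Enskog-tree level or by `kit`:
under the invariant canonical Gibbs law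
the conditional law of Σ_k M_ik v_k given the collision forest must be exactly Maxwellian — any
computed deviation kills
AdaptedWeightCLT for free. (ii) Event-driven MD at φ = 0.05–0.2, N = 10³–10⁵: propagate the 3(N+1)×3
tangent block
(two-row update per collision) and plot log PR(Δ) = −log ipr against the collision count — crux 3
predicts linear
growth until saturation at N, N-independently; an N-independent plateau ≪ N kills
DiffuseBackwardInfluence. (iii) the
stochastic hard-sphere Kac walk (biased trees, chaos available): CLT Maxwellisation there is the
unprinted rung the
refuter asked for; failure there retires the card. Not run here (plancard seat, no kit budget
requested).

NUMBERS. Scales at fixed σ: diameter ε = σ(N+1)^(−1/3); mean free path/time ≍ N^(−1/3) (≍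
(N+1)^(1/3) collisions per particle per
unit time, HardSphereEuler.lean docstring); window Δ_N = n_N·N^(−1/3), 1 ≪ n_N ≪ N^(1/3); blocks
N^(−1/3) ≪ ℓ_N ≪ Δ_N;
row budget Σ_k‖M_ik‖_F² = 3, ipr ∈ [9/(N+1), 9], one collision takes a fresh row from ipr 9 to 5
(cos²/sin² split of the
normal component), m generic collisions of a particle contract its self-block like Π(1 − (ω_j·e)²);
Kac-walk benchmark:
≍ N log N random rotations to Haar on S^(3N−1) versus ≍ N^(4/3) t reflections available per unit
time (card). Items at
open: 7 (1 target, 3 cruxes, 2 support, 1 assembly).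

DEFINITION REQUESTS. None. The frozen-geometry transfer, its inverse participation ratio and the
ℓ-block fields are inlined over
Literature.Analysis.FluidPDE.Alexander.{stateAfter, freeExitTime, incomingPairs, collisionCount},
collidePair, freeFlight
(import Literature.Analysis.FluidPDE.HardSphereFlowConstruction). A named `def velocityTransfer` in
Summits/AtomisticToContinuum/HydrodynamicLimit/Theorems would shorten the statements; to be
requested in tenure only if
grounders ask for it (restating would change signatures).

Novelty: Searches (2026-08-15): `lit frontier AtomisticToContinuum --since 2020` (30 rows; none on CLT
Maxwellisation of
deterministic gases; noted doi:10.1007/s10955-026-03570-w fluctuations for a binary collision model,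
arXiv:2310.13338
heat equation from deterministic dynamics); `lit bridges AtomisticToContinuum --cross any` (30 rows,
nothing closer);
`lit search --source crossref` ×5 ('central limit theorem Maxwellian Kac Boltzmann McKean' →
doi:10.1214/08-aap524,
doi:10.1007/bf02757134; 'Lindeberg principle dependent … Chatterjee' →
doi:10.1214/009117906000000575; 'hard sphere
tangent space dynamics Lyapunov modes …' → doi:10.1103/physreve.70.016207,
doi:10.1016/s0167-7322(01)00350-6; 'mechanical
model of Brownian motion Dürr Goldstein Lebowitz' → doi:10.1007/bf02046762; 'Carlen Carvalho Gabetta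
…' →
CarlenCarvalhoGabetta2000, doi:10.1016/j.jfa.2004.06.011); `lit search --hybrid --source local 'Wild
sums McKean central
limit theorem Maxwellian'` (10 held books: CercignaniGabetta2007 ch. 2 pp. 28–37, CIP1994 pp. 64–65,
Spohn1991);
`lit galaxy search … --star all/pdf` ×3 (service saturated / substring noise, 0 relevant); the
card's own 45-card
comparison and the refuter novelty audit of 2026-08-15 (67 cards).
Nearest prior art found: GabettaRegazzini2008 / DoleraRegazzini2010 / CarlenCarvalhoGabetta2000 /
Mckean1966 — CLT along
McKean–Wild trees for Kac/Maxwell molecules (stochastic, homogeneous, velocity-BLIND trees;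
CercignaniGabetta2007 p. 37:
'some adaptation (necessary because  [refs: 10.1007/s10955-026-03570-w, 10.1214/08-aap524, 10.1007/bf02757134, 10.1214/009117906000000575, 10.1103/physreve.70.016207, 10.1016/s0167-7322(01, 10.1007/bf02046762, 10.1016/j.jfa.2004.06.011, 2310.13338, doi:10.1007/s10955-026-03570-w, doi:10.1214/08-aap524, doi:10.1007/bf02757134, doi:10.1214/009117906000000575, doi:10.1103/physreve.70.016207, doi:10.1016/s0167-7322, doi:10.1007/bf02046762, doi:]

Barriers (technique_class: clt-lindeberg collision-isometries kinetic-closure): - technique_class: clt-lindeberg collision-isometries kinetic-closure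
- Literature.Barriers.AtomisticToContinuum.BoltzmannHypothesisBarrier: not in its technique class —
no entropy method, no classification of stationary states; the closure input is a CLT hypothesis
(diffuse adapted weights) that FAILS visibly on the barrier's kernels (ideal gas: M = I, ipr ≡ 9;
hard rods/swap rules: M a permutation), so collisions in d = 3 are used exactly through weight
splitting; conceded (refuter audit) that the narrowed barrier's flux-level content sits
substantively inside AdaptedWeightCLT, and KineticToHydro's collisional half is the same open input
as DissipativeWeakStrong's FluxClosure.
- Literature.Barriers.AtomisticToContinuum.BoltzmannHypothesisBarrierNarrow: its kernel (5) (a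
stationary free-gas state with a rest-frame heat current) is precisely ¬KC for σ = 0; the route's
statements are at σ > 0 fixed and extract Gaussianity from collisions, which the kernel lacks; the
bet is that diffuseness + adapted CLT is provable where the classification is not.
- Literature.Barriers.AtomisticToContinuum.HighMomentumCutoffBarrier: not met by cruxes 2–3 (bounded
functionals ipr ≤ 9; closure stated in probability, no moments); met inside KineticToHydro (cubic
tail of the energy flux for time-integrated L¹ convergence) — shared with every flux route, handled
there (apriori-tails-and-rattlers module).
- Literature.Barriers.AtomisticToContinuum.NoDensityExpansionBarrier: not met — nothing is expa

History (route lifecycle, newest last):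
- 2026-08-15T13:44:39Z · CLOSED retired — not-a-thesis: assembly does not conclude the sub-problem Statement (operator:999:1257524)
- 2026-08-15T13:55:47Z · CLOSED retired — not-a-thesis: assembly does not conclude the sub-problem Statement (operator:999:2305528)

sub-problem: HydrodynamicLimit · status: closed(retired) · opened planner-plancard-AtomisticToContinuum-Hydrody-7f49ed77-0 2026-08-15T11:43:50Z · rev 0 · ledger route-AtomisticToContinuum-MaxwellianCollisionCLT
GENERATED by the gate from the ledger (D-0016/17). Provers cite these decls: `theorem foo : Summit.AtomisticToContinuum.HydrodynamicLimit.Theses.MaxwellianCollisionCLT.<Decl> := …` in Summits/AtomisticToContinuum/HydrodynamicLimit/Theorems/<Name>.lean.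
-/

namespace Summit.AtomisticToContinuum.HydrodynamicLimit.Theses.MaxwellianCollisionCLT

open scoped BigOperators Topology Manifold Classical MeasureTheory ProbabilityTheory Matrix InnerProductSpace ComplexConjugate ContinuousMap
open Filter Set Function TopologicalSpace MeasureTheory

attribute [summit_statement] _root_.HydrodynamicLimit

/-- item stmt-AtomisticToContinuum-5999 · target · rank 0 · closed · moot by None · by planner
why it might fail: it is flux-level local equilibrium for deterministic spheres at fixed σ — no mechanism weaker than the conjunct's is known to give it (Spohn1991 I.3: no proof of such dynamical mixing); false for the free gas (rest-frame heat current, BoltzmannHypothesisBarrierNarrow kernel (5)).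
sources: Spohn1991, OllaVaradhanYau1993, CIP1994
[target] X as in § Thesis: ∀ continuous profiles ∃ σ₀ ∀ σ ∈ (0,σ₀) ∀ flows Φ ∃ mesoscale ℓ_N (0 <
ℓ_N → 0, (N+1)ℓ_N³ → ∞) ∀ t > 0 ∀ χ continuous ∀ δ > 0: localGibbsLaw-probability that the χ-tested
kinetic stress defect (entrywise) or kinetic energy-flux defect relative to the ℓ_N-block fields
(tent weights max(1 − dist/ℓ, 0), block mean velocity u_ℓ, block ⟨|v|²⟩ = e_ℓ, θ_ℓ = (e_ℓ −
|u_ℓ|²)/3, evaluated at each particle) of (Φ N).flow t z exceeds δ tends to 0. -/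
@[route_item "route-AtomisticToContinuum-MaxwellianCollisionCLT"]
def KineticClosure : Prop :=
  let bw := fun (N : ℕ) (y : Literature.Analysis.FluidPDE.Config (N + 1) (Fin 3) (UnitAddTorus (Fin 3))) (l : ℝ) (i j : Fin (N + 1)) => max (1 - dist (y j).1 (y i).1 / l) 0; let bu := fun (N : ℕ) (y : Literature.Analysis.FluidPDE.Config (N + 1) (Fin 3) (UnitAddTorus (Fin 3))) (l : ℝ) (i : Fin (N + 1)) => (∑ j, bw N y l i j)⁻¹ • ∑ j, bw N y l i j • (y j).2; let be := fun (N : ℕ) (y : Literature.Analysis.FluidPDE.Config (N + 1) (Fin 3) (UnitAddTorus (Fin 3))) (l : ℝ) (i : Fin (N + 1)) => (∑ j, bw N y l i j)⁻¹ * ∑ j, bw N y l i j * ‖(y j).2‖ ^ 2; let bθ := fun (N : ℕ) (y : Literature.Analysis.FluidPDE.Config (N + 1) (Fin 3) (UnitAddTorus (Fin 3))) (l : ℝ) (i : Fin (N + 1)) => (be N y l i - ‖bu N y l i‖ ^ 2) / 3; let S := fun (N : ℕ) (y : Literature.Analysis.FluidPDE.Config (N + 1) (Fin 3) (UnitAddTorus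 (Fin 3))) (l : ℝ) (χ : UnitAddTorus (Fin 3) → ℝ) (a b : Fin 3) => ((N + 1 : ℕ) : ℝ)⁻¹ * ∑ i, χ (y i).1 * ((y i).2 a * (y i).2 b - (bu N y l i a * bu N y l i b + (if a = b then bθ N y l i else 0))); let Q := fun (N : ℕ) (y : Literature.Analysis.FluidPDE.Config (N + 1) (Fin 3) (UnitAddTorus (Fin 3))) (l : ℝ) (χ : UnitAddTorus (Fin 3) → ℝ) (a : Fin 3) => ((N + 1 : ℕ) : ℝ)⁻¹ * ∑ i, χ (y i).1 * (‖(y i).2‖ ^ 2 / 2 * (y i).2 a - (be N y l i / 2 + bθ N y l i) * bu N y l i a); ∀ (a₀ θ₀ : UnitAddTorus (Fin 3) → ℝ) (u₀ : UnitAddTorus (Fin 3) → EuclideanSpace ℝ (Fin 3)), Continuous a₀ → Continuous θ₀ → Continuous u₀ → (∀ x, 0 < a₀ x) → (∀ x, 0 < θ₀ x) → ∃ σ₀ : ℝ, 0 < σ₀ ∧ ∀ σ : ℝ, 0 < σ → σ < σ₀ → ∀ Φ : (N : ℕ) → Literature.Analysis.FluidPDE.HardSphereFlow (Literature.Analysis.FluidPDE.Torus.geometry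 (Fin 3)) (Literature.MathematicalPhysics.KineticTheory.hsDiameter σ N) (N + 1), ∃ ℓ : ℕ → ℝ, (∀ N, 0 < ℓ N) ∧ Filter.Tendsto ℓ Filter.atTop (nhds 0) ∧ Filter.Tendsto (fun N : ℕ => ((N + 1 : ℕ) : ℝ) * ℓ N ^ 3) Filter.atTop Filter.atTop ∧ ∀ t : ℝ, 0 < t → ∀ χ : UnitAddTorus (Fin 3) → ℝ, Continuous χ → ∀ δ > (0 : ℝ), (∀ a b : Fin 3, Filter.Tendsto (fun N : ℕ => Literature.MathematicalPhysics.KineticTheory.localGibbsLaw σ a₀ u₀ θ₀ N (Φ N) {z | δ < |S N ((Φ N).flow t z) (ℓ N) χ a b|}) Filter.atTop (nhds 0)) ∧ (∀ a : Fin 3, Filter.Tendsto (fun N : ℕ => Literature.MathematicalPhysics.KineticTheory.localGibbsLaw σ a₀ u₀ θ₀ N (Φ N) {z | δ < |Q N ((Φ N).flow t z) (ℓ N) χ a|}) Filter.atTop (nhds 0))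

/-- item stmt-AtomisticToContinuum-6000 · crux · rank 2 · closed · moot by None · by planner
why it might fail: the weights are adapted (collision times/normals depend on the summands; |g·ω|-biased tree): selection bias may tilt the limit off Gaussian at O(1) unless it enters only via the flux factor — 'chaos in CLT clothing' (refuter audit); ancestor decorrelation at scale N^(-1/3) is open.
sources: Chatterjee2006, GabettaRegazzini2008, DoleraRegazzini2010, CarlenCarvalhoGabetta2000, Mckean1966, CercignaniGabetta2007
[crux] card crux 2 (ADAPTED-WEIGHT CLT ⇒ LOCAL MAXWELLIAN): ∀ profiles ∃ σ₀ ∀ σ < σ₀ ∀ Φ ∀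
window/block sequences Δ_N, ℓ_N > 0 with Δ_N → 0, ℓ_N/Δ_N → 0, (N+1)ℓ_N³ → ∞, ∀ t > 0: IF the
frozen-geometry velocity transfer M over [t−Δ_N, t] (fold of the linear collision reflections of the
Alexander construction started at (Φ N).flow (t−Δ_N) z) has vanishing mean inverse participation
ratio E[(N+1)⁻¹Σᵢ Σ_k ‖M_ik‖_F⁴] → 0 under the local Gibbs law, THEN the kinetic closure KC(t, ℓ) of
the target holds at t. Rotational diffuseness of the products of reflections and pair decorrelation
of ancestor velocities at kinetic separations are to be proved inside (foreseen split). [difficulty: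
XL] -/
@[route_item "route-AtomisticToContinuum-MaxwellianCollisionCLT"]
def AdaptedWeightCLT : Prop :=
  let bw := fun (N : ℕ) (y : Literature.Analysis.FluidPDE.Config (N + 1) (Fin 3) (UnitAddTorus (Fin 3))) (l : ℝ) (i j : Fin (N + 1)) => max (1 - dist (y j).1 (y i).1 / l) 0; let bu := fun (N : ℕ) (y : Literature.Analysis.FluidPDE.Config (N + 1) (Fin 3) (UnitAddTorus (Fin 3))) (l : ℝ) (i : Fin (N + 1)) => (∑ j, bw N y l i j)⁻¹ • ∑ j, bw N y l i j • (y j).2; let be := fun (N : ℕ) (y : Literature.Analysis.FluidPDE.Config (N + 1) (Fin 3) (UnitAddTorus (Fin 3))) (l : ℝ) (i : Fin (N + 1)) => (∑ j, bw N y l i j)⁻¹ * ∑ j, bw N y l i j * ‖(y j).2‖ ^ 2; let bθ := fun (N : ℕ) (y : Literature.Analysis.FluidPDE.Config (N + 1) (Fin 3) (UnitAddTorus (Fin 3))) (l : ℝ) (i : Fin (N + 1)) => (be N y l i - ‖bu N y l i‖ ^ 2) / 3; let S := fun (N : ℕ) (y : Literature.Analysis.FluidPDE.Config (N + 1) (Fin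 3) (UnitAddTorus (Fin 3))) (l : ℝ) (χ : UnitAddTorus (Fin 3) → ℝ) (a b : Fin 3) => ((N + 1 : ℕ) : ℝ)⁻¹ * ∑ i, χ (y i).1 * ((y i).2 a * (y i).2 b - (bu N y l i a * bu N y l i b + (if a = b then bθ N y l i else 0))); let Q := fun (N : ℕ) (y : Literature.Analysis.FluidPDE.Config (N + 1) (Fin 3) (UnitAddTorus (Fin 3))) (l : ℝ) (χ : UnitAddTorus (Fin 3) → ℝ) (a : Fin 3) => ((N + 1 : ℕ) : ℝ)⁻¹ * ∑ i, χ (y i).1 * (‖(y i).2‖ ^ 2 / 2 * (y i).2 a - (be N y l i / 2 + bθ N y l i) * bu N y l i a); ∀ (a₀ θ₀ : UnitAddTorus (Fin 3) → ℝ) (u₀ : UnitAddTorus (Fin 3) → EuclideanSpace ℝ (Fin 3)), Continuous a₀ → Continuous θ₀ → Continuous u₀ → (∀ x, 0 < a₀ x) → (∀ x, 0 < θ₀ x) → ∃ σ₀ : ℝ, 0 < σ₀ ∧ ∀ σ : ℝ, 0 < σ → σ < σ₀ → let M : (N : ℕ) → Literature.Analysis.FluidPDE.Config (N + 1) (Fin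 3) (UnitAddTorus (Fin 3)) → ℝ → (Fin (N + 1) → EuclideanSpace ℝ (Fin 3)) → (Fin (N + 1) → EuclideanSpace ℝ (Fin 3)) := (fun N y Δ W => let G := Literature.Analysis.FluidPDE.Torus.geometry (Fin 3); let ε : ℝ := Literature.MathematicalPhysics.KineticTheory.hsDiameter σ N; let pre : ℕ → Literature.Analysis.FluidPDE.Config (N + 1) (Fin 3) (UnitAddTorus (Fin 3)) := fun k => let zk := Literature.Analysis.FluidPDE.Alexander.stateAfter G ε y k; Literature.Analysis.FluidPDE.freeFlight G (Literature.Analysis.FluidPDE.Alexander.freeExitTime G ε zk).toReal zk; (List.range (Literature.Analysis.FluidPDE.Alexander.collisionCount G ε y Δ)).foldl (fun W' k => @dite (Fin (N + 1) → EuclideanSpace ℝ (Fin 3)) (Literature.Analysis.FluidPDE.Alexander.incomingPairs G ε (pre k)).Nonempty (Classical.propDecidable _) (fun h => fun i => (Literature.Analysis.FluidPDE.collidePair G h.some.1 h.some.2 (fun j => ((pre k j).1, W' j)) i).2) (fun _ => W')) W); let ipr : (N : ℕ) → Literature.Analysis.FluidPDE.Config (N + 1) (Fin 3) (UnitAddTorus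 (Fin 3)) → ℝ → ℝ := fun N y Δ => ((N + 1 : ℕ) : ℝ)⁻¹ * ∑ i : Fin (N + 1), ∑ k : Fin (N + 1), (∑ a : Fin 3, ‖M N y Δ (Pi.single k (EuclideanSpace.single a (1 : ℝ))) i‖ ^ 2) ^ 2; ∀ Φ : (N : ℕ) → Literature.Analysis.FluidPDE.HardSphereFlow (Literature.Analysis.FluidPDE.Torus.geometry (Fin 3)) (Literature.MathematicalPhysics.KineticTheory.hsDiameter σ N) (N + 1), ∀ Δ ℓ : ℕ → ℝ, (∀ N, 0 < Δ N) → (∀ N, 0 < ℓ N) → Filter.Tendsto Δ Filter.atTop (nhds 0) → Filter.Tendsto (fun N : ℕ => ℓ N / Δ N) Filter.atTop (nhds 0) → Filter.Tendsto (fun N : ℕ => ((N + 1 : ℕ) : ℝ) * ℓ N ^ 3) Filter.atTop Filter.atTop → ∀ t : ℝ, 0 < t → Filter.Tendsto (fun N : ℕ => ∫⁻ z, ENNReal.ofReal (ipr N ((Φ N).flow (t - Δ N) z) (Δ N)) ∂(Literature.MathematicalPhysics.KineticTheory.localGibbsLaw σ a₀ u₀ θ₀ N (Φ N))) Filter.atTop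 (nhds 0) → ∀ χ : UnitAddTorus (Fin 3) → ℝ, Continuous χ → ∀ δ > (0 : ℝ), (∀ a b : Fin 3, Filter.Tendsto (fun N : ℕ => Literature.MathematicalPhysics.KineticTheory.localGibbsLaw σ a₀ u₀ θ₀ N (Φ N) {z | δ < |S N ((Φ N).flow t z) (ℓ N) χ a b|}) Filter.atTop (nhds 0)) ∧ (∀ a : Fin 3, Filter.Tendsto (fun N : ℕ => Literature.MathematicalPhysics.KineticTheory.localGibbsLaw σ a₀ u₀ θ₀ N (Φ N) {z | δ < |Q N ((Φ N).flow t z) (ℓ N) χ a|}) Filter.atTop (nhds 0))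

/-- item stmt-AtomisticToContinuum-6001 · crux · rank 3 · closed · moot by None · by planner
why it might fail: weight re-concentration in transient dense clusters (rattlers) or a non-vanishing fraction of particles with O(1) collisions in n_N mean free times; O(φ)-rare per step, but 'uniform in N along the non-equilibrium law at t > 0' has no a-priori estimate beyond energy/entropy.
sources: SimanyiSzasz1999, CIP1994, GST2013, DewijnVanbeijeren2004, Alexander1975
[crux] card crux 1 (DIFFUSE BACKWARD INFLUENCE, uniform in N): ∀ profiles ∃ σ₀ ∀ σ < σ₀ ∀ Φ ∃ window
Δ_N > 0 with Δ_N → 0 and Δ_N(N+1)^(1/3) → ∞ (n_N → ∞ mean free times) such that ∀ t > 0 the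
local-Gibbs expectation of the mean inverse participation ratio (N+1)⁻¹Σᵢ Σ_k ‖M_ik(t, t−Δ_N)‖_F⁴ of
the rows of the frozen-geometry transfer tends to 0 (rows have ‖·‖_F² = 3 exactly, TransferIsometry;
ipr ∈ [9/(N+1), 9]). [difficulty: L] -/
@[route_item "route-AtomisticToContinuum-MaxwellianCollisionCLT"]
def DiffuseBackwardInfluence : Prop :=
  ∀ (a₀ θ₀ : UnitAddTorus (Fin 3) → ℝ) (u₀ : UnitAddTorus (Fin 3) → EuclideanSpace ℝ (Fin 3)), Continuous a₀ → Continuous θ₀ → Continuous u₀ → (∀ x, 0 < a₀ x) → (∀ x, 0 < θ₀ x) → ∃ σ₀ : ℝ, 0 < σ₀ ∧ ∀ σ : ℝ, 0 < σ → σ < σ₀ → let M : (N : ℕ) → Literature.Analysis.FluidPDE.Config (N + 1) (Fin 3) (UnitAddTorus (Fin 3)) → ℝ → (Fin (N + 1) → EuclideanSpace ℝ (Fin 3)) → (Fin (N + 1) → EuclideanSpace ℝ (Fin 3)) := (fun N y Δ W => let G := Literature.Analysis.FluidPDE.Torus.geometry (Fin 3); let ε : ℝ := Literature.MathematicalPhysics.KineticTheory.hsDiameter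 σ N; let pre : ℕ → Literature.Analysis.FluidPDE.Config (N + 1) (Fin 3) (UnitAddTorus (Fin 3)) := fun k => let zk := Literature.Analysis.FluidPDE.Alexander.stateAfter G ε y k; Literature.Analysis.FluidPDE.freeFlight G (Literature.Analysis.FluidPDE.Alexander.freeExitTime G ε zk).toReal zk; (List.range (Literature.Analysis.FluidPDE.Alexander.collisionCount G ε y Δ)).foldl (fun W' k => @dite (Fin (N + 1) → EuclideanSpace ℝ (Fin 3)) (Literature.Analysis.FluidPDE.Alexander.incomingPairs G ε (pre k)).Nonempty (Classical.propDecidable _) (fun h => fun i => (Literature.Analysis.FluidPDE.collidePair G h.some.1 h.some.2 (fun j => ((pre k j).1, W' j)) i).2) (fun _ => W')) W); let ipr : (N : ℕ) → Literature.Analysis.FluidPDE.Config (N + 1) (Fin 3) (UnitAddTorus (Fin 3)) → ℝ → ℝ := fun N y Δ => ((N + 1 : ℕ) : ℝ)⁻¹ * ∑ i : Fin (N + 1), ∑ k : Fin (N + 1), (∑ a : Fin 3, ‖M N y Δ (Pi.single k (EuclideanSpace.single a (1 : ℝ))) i‖ ^ 2) ^ 2; ∀ Φ : (N : ℕ) →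 Literature.Analysis.FluidPDE.HardSphereFlow (Literature.Analysis.FluidPDE.Torus.geometry (Fin 3)) (Literature.MathematicalPhysics.KineticTheory.hsDiameter σ N) (N + 1), ∃ Δ : ℕ → ℝ, (∀ N, 0 < Δ N) ∧ Filter.Tendsto Δ Filter.atTop (nhds 0) ∧ Filter.Tendsto (fun N : ℕ => Δ N * ((N + 1 : ℕ) : ℝ) ^ ((1 : ℝ) / 3)) Filter.atTop Filter.atTop ∧ ∀ t : ℝ, 0 < t → Filter.Tendsto (fun N : ℕ => ∫⁻ z, ENNReal.ofReal (ipr N ((Φ N).flow (t - Δ N) z) (Δ N)) ∂(Literature.MathematicalPhysics.KineticTheory.localGibbsLaw σ a₀ u₀ θ₀ N (Φ N))) Filter.atTop (nhds 0)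

/-- item stmt-AtomisticToContinuum-6002 · crux · rank 4 · closed · moot by None · by planner
why it might fail: collisional transfer needs contact-pair statistics at distance ε, untouched by this engine; if contact correlations stay non-product at leading order the collisional pressure is not ρθ(Z−1) and HydrodynamicLimit fails with KineticClosure true; entropy admissibility of limit points is open too.
sources: BrezinaFeireisl2018, Dafermos1979, Spohn1991, OllaVaradhanYau1993, KipnisLandim1999
[crux] card crux 3 (COLLISIONAL HALF + TAILS + ASSEMBLY): KineticClosure → HydrodynamicLimit. Given
the kinetic half at one mesoscale, derive the conjunct: collisional momentum/energy transfer closes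
to the excess pressure ρθ(Z(ρσ³) − 1)𝟙 and its work flux (virial, contact-pair statistics at fixed
σ), cubic velocity tails give time-integrated L¹ fluxes, limit points are dissipative measure-valued
hs-Euler solutions and relative-energy weak–strong uniqueness (BrezinaFeireisl2018, Dafermos1979;
route DissipativeWeakStrong items FluxClosure/HsEntropyConvex) pins them to the classical solution
before the first shock; t = 0 from the LLN hypothesis. [deps: KineticClosure] [difficulty: XL] -/
@[route_item "route-AtomisticToContinuum-MaxwellianCollisionCLT"]
def KineticToHydro : Prop :=
  (let bw := fun (N : ℕ) (y : Literature.Analysis.FluidPDE.Config (N + 1) (Fin 3) (UnitAddTorus (Fin 3))) (l : ℝ) (i j : Fin (N + 1)) => max (1 - dist (y j).1 (y i).1 / l) 0; let bu := fun (N : ℕ) (y : Literature.Analysis.FluidPDE.Config (N + 1) (Fin 3) (UnitAddTorus (Fin 3))) (l : ℝ) (i : Fin (N + 1)) => (∑ j, bw N y l i j)⁻¹ • ∑ j, bw N y l i j • (y j).2; let be := fun (N : ℕ) (y : Literature.Analysis.FluidPDE.Config (N + 1) (Fin 3) (UnitAddTorus (Fin 3))) (l : ℝ) (i : Fin (N +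 1)) => (∑ j, bw N y l i j)⁻¹ * ∑ j, bw N y l i j * ‖(y j).2‖ ^ 2; let bθ := fun (N : ℕ) (y : Literature.Analysis.FluidPDE.Config (N + 1) (Fin 3) (UnitAddTorus (Fin 3))) (l : ℝ) (i : Fin (N + 1)) => (be N y l i - ‖bu N y l i‖ ^ 2) / 3; let S := fun (N : ℕ) (y : Literature.Analysis.FluidPDE.Config (N + 1) (Fin 3) (UnitAddTorus (Fin 3))) (l : ℝ) (χ : UnitAddTorus (Fin 3) → ℝ) (a b : Fin 3) => ((N + 1 : ℕ) : ℝ)⁻¹ * ∑ i, χ (y i).1 * ((y i).2 a * (y i).2 b - (bu N y l i a * bu N y l i b + (if a = b then bθ N y l i else 0))); let Q := fun (N : ℕ) (y : Literature.Analysis.FluidPDE.Config (N + 1) (Fin 3) (UnitAddTorus (Fin 3))) (l : ℝ) (χ : UnitAddTorus (Fin 3) → ℝ) (a : Fin 3) => ((N + 1 : ℕ) : ℝ)⁻¹ * ∑ i, χ (y i).1 * (‖(y i).2‖ ^ 2 / 2 * (y i).2 a - (be N y l i / 2 + bθ N y l i) * bu N y l i a); ∀ (a₀ θ₀ : UnitAddTorus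 (Fin 3) → ℝ) (u₀ : UnitAddTorus (Fin 3) → EuclideanSpace ℝ (Fin 3)), Continuous a₀ → Continuous θ₀ → Continuous u₀ → (∀ x, 0 < a₀ x) → (∀ x, 0 < θ₀ x) → ∃ σ₀ : ℝ, 0 < σ₀ ∧ ∀ σ : ℝ, 0 < σ → σ < σ₀ → ∀ Φ : (N : ℕ) → Literature.Analysis.FluidPDE.HardSphereFlow (Literature.Analysis.FluidPDE.Torus.geometry (Fin 3)) (Literature.MathematicalPhysics.KineticTheory.hsDiameter σ N) (N + 1), ∃ ℓ : ℕ → ℝ, (∀ N, 0 < ℓ N) ∧ Filter.Tendsto ℓ Filter.atTop (nhds 0) ∧ Filter.Tendsto (fun N : ℕ => ((N + 1 : ℕ) : ℝ) * ℓ N ^ 3) Filter.atTop Filter.atTop ∧ ∀ t : ℝ, 0 < t → ∀ χ : UnitAddTorus (Fin 3) → ℝ, Continuous χ → ∀ δ > (0 : ℝ), (∀ a b : Fin 3, Filter.Tendsto (fun N : ℕ => Literature.MathematicalPhysics.KineticTheory.localGibbsLaw σ a₀ u₀ θ₀ N (Φ N) {z | δ < |S N ((Φ N).flow t z) (ℓ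 N) χ a b|}) Filter.atTop (nhds 0)) ∧ (∀ a : Fin 3, Filter.Tendsto (fun N : ℕ => Literature.MathematicalPhysics.KineticTheory.localGibbsLaw σ a₀ u₀ θ₀ N (Φ N) {z | δ < |Q N ((Φ N).flow t z) (ℓ N) χ a|}) Filter.atTop (nhds 0))) → Literature.MathematicalPhysics.KineticTheory.HydrodynamicLimit

/-- item stmt-AtomisticToContinuum-6003 · support · rank 9 · closed · moot by None · by planner
sources: CIP1994, GST2013, SimanyiSzasz1999
[support] for every σ, N, configuration y and Δ the frozen-geometry transfer W ↦ M N y Δ W (fold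
over k < collisionCount of: replace velocities by W, collide the incoming contact pair of the k-th
pre-collisional configuration of the Alexander dynamics) is additive, homogeneous, preserves
Σᵢ‖Wᵢ‖², and every row has Frobenius weight Σ_k Σ_a ‖M(e_k⊗e_a)ᵢ‖² = 3 (orthogonality; reflectVel is
a linear isometry of V3×V3 for every normal, identity at 0). [difficulty: provable-now] -/
@[route_item "route-AtomisticToContinuum-MaxwellianCollisionCLT"]
def TransferIsometry : Prop :=
  ∀ (σ : ℝ), let M : (N : ℕ) → Literature.Analysis.FluidPDE.Config (N + 1) (Fin 3) (UnitAddTorus (Fin 3)) → ℝ → (Fin (N + 1) → EuclideanSpace ℝ (Fin 3)) → (Fin (N + 1) → EuclideanSpace ℝ (Fin 3)) := (fun N y Δ W => let G := Literature.Analysis.FluidPDE.Torus.geometry (Fin 3); let ε : ℝ := Literature.MathematicalPhysics.KineticTheory.hsDiameter σ N; let pre : ℕ → Literature.Analysis.FluidPDE.Config (N + 1) (Fin 3) (UnitAddTorus (Fin 3)) := fun k => let zk := Literature.Analysis.FluidPDE.Alexander.stateAfter G ε y k; Literature.Analysis.FluidPDE.freeFlight G (Literature.Analysis.FluidPDE.Alexander.freeExitTime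 G ε zk).toReal zk; (List.range (Literature.Analysis.FluidPDE.Alexander.collisionCount G ε y Δ)).foldl (fun W' k => @dite (Fin (N + 1) → EuclideanSpace ℝ (Fin 3)) (Literature.Analysis.FluidPDE.Alexander.incomingPairs G ε (pre k)).Nonempty (Classical.propDecidable _) (fun h => fun i => (Literature.Analysis.FluidPDE.collidePair G h.some.1 h.some.2 (fun j => ((pre k j).1, W' j)) i).2) (fun _ => W')) W); ∀ (N : ℕ) (y : Literature.Analysis.FluidPDE.Config (N + 1) (Fin 3) (UnitAddTorus (Fin 3))) (Δ : ℝ), (∀ W₁ W₂ : Fin (N + 1) → EuclideanSpace ℝ (Fin 3), M N y Δ (W₁ + W₂) = M N y Δ W₁ + M N y Δ W₂) ∧ (∀ (c : ℝ) (W : Fin (N + 1) → EuclideanSpace ℝ (Fin 3)), M N y Δ (c • W) = c • M N y Δ W) ∧ (∀ W : Fin (N + 1) → EuclideanSpace ℝ (Fin 3), ∑ i, ‖M N y Δ W i‖ ^ 2 = ∑ i, ‖W i‖ ^ 2) ∧ (∀ i : Fin (N + 1), ∑ k : Fin (N + 1), ∑ a : Fin 3, ‖M N y Δ (Pi.single k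 (EuclideanSpace.single a (1 : ℝ))) i‖ ^ 2 = 3)

/-- item stmt-AtomisticToContinuum-6004 · support · rank 9 · closed · moot by None · by planner
sources: Alexander1975, CIP1994, GST2013
[support] for 0 < σ < 1/2, every N, every hard-sphere flow Φ of N+1 spheres of diameter hsDiameter σ
N on 𝕋³, every s and Δ ≥ 0: for Liouville-a.e. z the velocities of Φ.flow (s+Δ) z are the transfer M
N (Φ.flow s z) Δ applied to the velocities of Φ.flow s z (trajectory uniqueness GST2013 §4.1 /
flow_eq_ae_holds + torusFlow_isTrajectory/ae_good/measurePreserving_holds + hsDiameter_le; induction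
on the collision count: freeFlight keeps velocities, collisionStep = collidePair at the
pre-collisional positions). [difficulty: provable-now] -/
@[route_item "route-AtomisticToContinuum-MaxwellianCollisionCLT"]
def TransferRepresentsFlow : Prop :=
  ∀ (σ : ℝ), 0 < σ → σ < 2⁻¹ → let M : (N : ℕ) → Literature.Analysis.FluidPDE.Config (N + 1) (Fin 3) (UnitAddTorus (Fin 3)) → ℝ → (Fin (N + 1) → EuclideanSpace ℝ (Fin 3)) → (Fin (N + 1) → EuclideanSpace ℝ (Fin 3)) := (fun N y Δ W => let G := Literature.Analysis.FluidPDE.Torus.geometry (Fin 3); let ε : ℝ := Literature.MathematicalPhysics.KineticTheory.hsDiameter σ N; let pre : ℕ → Literature.Analysis.FluidPDE.Config (N + 1) (Fin 3) (UnitAddTorus (Fin 3)) := fun k => let zk := Literature.Analysis.FluidPDE.Alexander.stateAfter G ε y k; Literature.Analysis.FluidPDE.freeFlight G (Literature.Analysis.FluidPDE.Alexander.freeExitTime G ε zk).toReal zk; (List.range (Literature.Analysis.FluidPDE.Alexander.collisionCount G ε y Δ)).foldl (fun W' k => @dite (Fin (N + 1) → EuclideanSpace ℝ (Fin 3)) (Literature.Analysis.FluidPDE.Alexander.incomingPairs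 G ε (pre k)).Nonempty (Classical.propDecidable _) (fun h => fun i => (Literature.Analysis.FluidPDE.collidePair G h.some.1 h.some.2 (fun j => ((pre k j).1, W' j)) i).2) (fun _ => W')) W); ∀ (N : ℕ) (Φ : Literature.Analysis.FluidPDE.HardSphereFlow (Literature.Analysis.FluidPDE.Torus.geometry (Fin 3)) (Literature.MathematicalPhysics.KineticTheory.hsDiameter σ N) (N + 1)) (s Δ : ℝ), 0 ≤ Δ → Filter.Eventually (fun z => (fun i => (Φ.flow (s + Δ) z i).2) = M N (Φ.flow s z) Δ (fun i => (Φ.flow s z i).2)) (MeasureTheory.ae (Literature.Analysis.FluidPDE.liouville (Literature.Analysis.FluidPDE.Torus.geometry (Fin 3)) (N + 1) (Literature.MathematicalPhysics.KineticTheory.hsDiameter σ N)))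

/-- item stmt-AtomisticToContinuum-6005 · assembly · rank 1 · closed · moot by None · by planner
sources: Spohn1991, OllaVaradhanYau1993
[assembly] DiffuseBackwardInfluence → AdaptedWeightCLT → KineticToHydro → HydrodynamicLimit. -/
@[route_item "route-AtomisticToContinuum-MaxwellianCollisionCLT"]
def Assembly : Prop :=
  DiffuseBackwardInfluence → AdaptedWeightCLT → KineticToHydro → Literature.MathematicalPhysics.KineticTheory.HydrodynamicLimit

end Summit.AtomisticToContinuum.HydrodynamicLimit.Theses.MaxwellianCollisionCLT
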